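import Literature.NumberTheory.Transcendental.KZSemiCanonicalReductionProofs
import Literature.NumberTheory.Transcendental.SemialgebraicAlgebraicPoints

/-!
# `VolumeFormOffPlane` (stmt-KontsevichZagierPeriods-14935) — line `Sketch`,
stub `stub_subgraphToBase`

Target: `Summits/KontsevichZagierPeriods/KontsevichZagierPeriods/Theorems/SymplecticScissorsVolumeFormOffPlaneSubgraphToBase.lean`.
The theorem `stub_subgraphToBase` below keeps EXACTLY the registered signature.

**Curved cells.** The solid under the graph of a `ℚ`-semialgebraic `f ≥ 0` over a base domain
`D ⊆ ℝⁿ`, `{(x, t) | x ∈ D, 0 ≤ t ≤ f x}` with integrand `1`, differs by relations from the base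
representation `[D, f]`: this is ONE move of Kontsevich–Zagier's rule (3) (Newton–Leibniz along the
last coordinate, `KZ.newtonLeibnizRel`) with primitive `F (x, t) = t`, lower bound `a = 0` and upper
bound `b = f`: `∂F/∂t = 1` is the integrand on the band and `F (x, f x) − F (x, 0) = f x` is the
integrand of the base.

## References

* M. Kontsevich, D. Zagier, *Periods* (2001), §1.2 rule (3).
-/

noncomputable section

open MeasureTheory Set
open Literature.NumberTheory.Transcendental

namespace Summit.KontsevichZagierPeriods.SymplecticScissors.LogPolytope

/-- **The solid under a graph is its base weighted by the height** (`[{x ∈ D, 0 ≤ t ≤ f x}, 1] ≡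
[D, f]`): for a `ℚ`-semialgebraic `f ≥ 0` on the base domain `D = r'.domain`, the integrand-`1`
representation `r` on the band `{z | init z ∈ D, 0 ≤ z last ≤ f (init z)}` and the base
representation `r'` with integrand `f` on `D` differ by ONE Newton–Leibniz move (rule (3)) with
primitive `F z = z last`, bounds `a = 0 ≤ b = f`: on each fibre `t ↦ t` is continuous with
derivative `1 = r.integrand` on `(0, f x)`, and `F (x, f x) − F (x, 0) = f x = r'.integrand x`.
[Kontsevich–Zagier 2001, §1.2, rule (3)] [folklore] -/
theorem stub_subgraphToBase : ∀ (n : ℕ) (r : KZ.IntegralRep (n + 1)) (r' : KZ.IntegralRep n)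
    (f : (Fin n → ℝ) → ℝ),
    IsSemialgebraicFunOn ℚ r'.domain f → (∀ x ∈ r'.domain, 0 ≤ f x) →
    r.domain = {z : Fin (n + 1) → ℝ | (Fin.init z : Fin n → ℝ) ∈ r'.domain ∧ 0 ≤ z (Fin.last n) ∧
        z (Fin.last n) ≤ f (Fin.init z)} →
    (∀ z ∈ r.domain, r.integrand z = 1) → (∀ x ∈ r'.domain, r'.integrand x = f x) →
    KZ.of r - KZ.of r' ∈ KZ.relations := by
  intro n r r' f hf hf0 hdom hri hr'i
  refine KZ.newtonLeibnizRel_subset_relations ⟨n, r, r', fun _ => 0, f,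
    fun w => w (Fin.last n), ?_, ?_, hf, hf0, ?_, ?_, ?_, ?_, rfl⟩
  · -- the primitive `F z = z last` is a polynomial, hence semialgebraic on the band
    simpa using isSemialgebraicFunOn_aeval r.isSemialgebraic_domain
      (MvPolynomial.X (Fin.last n) : MvPolynomial (Fin (n + 1)) ℚ)
  · -- the lower bound `a = 0` is a polynomial, hence semialgebraic on the base
    simpa using isSemialgebraicFunOn_aeval r'.isSemialgebraic_domain
      (0 : MvPolynomial (Fin n) ℚ)
  · -- the band equation is the hypothesis
    rw [hdom]
  · -- continuity of `t ↦ t` on `[0, f x]`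
    intro x _
    simp only [Fin.snoc_last]
    exact continuousOn_id
  · -- derivative of `t ↦ t` on `(0, f x)` is `1 = r.integrand (x, t)` (the point is in the band)
    intro x hx t ht
    have hmem : (Fin.snoc x t : Fin (n + 1) → ℝ) ∈ r.domain := by
      rw [hdom]
      simp only [mem_setOf_eq, Fin.init_snoc, Fin.snoc_last]
      exact ⟨hx, ht.1.le, ht.2.le⟩
    rw [hri _ hmem]
    simp only [Fin.snoc_last]
    exact hasDerivAt_id' t
  · -- `r'.integrand x = f x = F (x, f x) - F (x, 0)`
    intro x hx
    simp only [Fin.snoc_last, sub_zero]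
    exact hr'i x hx

end Summit.KontsevichZagierPeriods.SymplecticScissors.LogPolytope

end
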